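import Summits.Ventures.PercRepro.C026GluingCount
import Summits.Ventures.PercRepro.C026GluingTransport

/-!
# The composition theorem for gluings with any number of colours (p6, gen 9)

mine-3's composition theorem (`dFreeIneq_of_gluing`, `C026GluingCount.lean`) composes the D-free
inequality over a gluing of TWO parts at the marks `a, b, c`.  This file iterates it: for edges coloured
by an arbitrary type `ι` (`col : E → ι`) such that every vertex other than the marks carries edges of
one colour only (`IsGluingN`), the D-free inequality for every colour class (`colPart col i`) gives the
D-free inequality for `G`.

* `IsGluingN`, `colPart col i` (the part of colour `i`; over `Bool` the landed `part`, `colPart_eq_part`),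
  `colSub col s` (the edges of colour in the finset `s`); a 3-terminal (two-coloured) gluing is an
  `IsGluingN` over `Bool` (`IsGluing.isGluingN`); `IsGluingN` is decidable on finite types
  (`decidableIsGluingN`);
* `dFreeIneq_of_isEmpty` — a graph without edges satisfies the D-free inequality (`bot ∩ {a ~ b}` is
  empty), the base of the induction;
* `dFreeIneq_of_edgeEquiv` — `dFreeIneq_map` with `φ = id`: the inequality transports along an
  endpoint-preserving bijection of edge types;
* `isGluing_colSub` — the edges of colour in `insert i s` are a two-coloured gluing («colour `i`» versus
  «colour in `s`»), whose parts are `colPart col i` and `colSub col s` up to `colEquivTrue` /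
  `colEquivFalse`;
* **`dFreeIneq_colSub`** (induction on `s`) and **`dFreeIneq_of_gluingN`** — the theorem of record —
  with its instance `dFreeIneq_of_gluingFin` for `n` colours `Fin n` and the corollary
  `dFreeIneq_of_gluingN_starPrime` (colour classes satisfying `(★′)`).
-/

namespace PercRepro

namespace MultiGraph

section GluingN

variable {V E ι : Type*} (G : MultiGraph V E)

/-- **An `ι`-coloured gluing**: every vertex other than the marks `a, b, c` is incident to edges of one
colour only. -/
def IsGluingN (a b c : V) (col : E → ι) : Prop :=
  ∀ v, v ≠ a → v ≠ b → v ≠ c → ∀ e e', G.EdgeAt e v → G.EdgeAt e' v → col e = col e'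

/-- The part of colour `i`: the same vertices, the edges of colour `i`. -/
def colPart (col : E → ι) (i : ι) : MultiGraph V {e // col e = i} :=
  ⟨fun e => G.fst e.1, fun e => G.snd e.1⟩

/-- The subgraph on the edges whose colour lies in the finset `s`. -/
def colSub (col : E → ι) (s : Finset ι) : MultiGraph V {e // col e ∈ s} :=
  ⟨fun e => G.fst e.1, fun e => G.snd e.1⟩

/-- The two-colouring «colour `i`, or not» of the edges of colour in `insert i s`. -/
def colSide [DecidableEq ι] (col : E → ι) (i : ι) (s : Finset ι) :
    {e // col e ∈ insert i s} → Bool :=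
  fun e => decide (col e.1 = i)

/-- `EdgeAt` is decidable when the vertex type has decidable equality. -/
instance decidableEdgeAt [DecidableEq V] (e : E) (v : V) : Decidable (G.EdgeAt e v) := by
  unfold EdgeAt
  infer_instance

/-- `IsGluingN` is decidable on finite types, so concrete gluings are instances by `decide`. -/
instance decidableIsGluingN [Fintype V] [Fintype E] [DecidableEq V] [DecidableEq ι] (a b c : V)
    (col : E → ι) : Decidable (G.IsGluingN a b c col) := by
  unfold IsGluingN
  infer_instance

/-- For a `Bool`-colouring the colour parts are the parts of `C026GluingDefs`. -/
theorem colPart_eq_part (side : E → Bool) (s : Bool) : G.colPart side s = G.part side s := rfl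

variable {G}

/-- A two-coloured gluing is an `IsGluingN` over `Bool`. -/
theorem IsGluing.isGluingN {a b c : V} {side : E → Bool} (hg : G.IsGluing a b c side) :
    G.IsGluingN a b c side :=
  hg

/-- An `IsGluingN` over `Bool` is a two-coloured gluing. -/
theorem IsGluingN.isGluing {a b c : V} {side : E → Bool} (hg : G.IsGluingN a b c side) :
    G.IsGluing a b c side :=
  hg

/-- In a graph without edges every walk is trivial. -/
theorem Conn.eq_of_isEmpty {E' : Type*} [IsEmpty E'] {H : MultiGraph V E'} {ω : Config E'} {u v : V}
    (h : H.Conn ω u v) : u = v := by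
  unfold Conn at h
  induction h with
  | refl => rfl
  | tail _ hxy _ =>
    obtain ⟨e, _⟩ := hxy
    exact isEmptyElim e

open Classical in
/-- **A graph without edges satisfies the D-free inequality**: no `bot` configuration has `a ~ b` in
`δ(S)`, so the left-hand count is `0`. -/
theorem dFreeIneq_of_isEmpty {E' : Type*} [Fintype E'] [DecidableEq E'] [IsEmpty E']
    (H : MultiGraph V E') (a b c : V) : H.DFreeIneq a b c := by
  unfold DFreeIneq
  have hempty : ∀ ω : Config E', ¬ H.BotM ω a b c := fun ω hω => by
    obtain ⟨hb, hconn⟩ := hω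
    rw [Conn.eq_of_isEmpty hconn] at hb
    exact hb.1 (Conn.refl _ _ _)
  rw [Finset.filter_eq_empty_iff.mpr fun ω _ => hempty ω, Finset.card_empty]
  exact Nat.zero_le _

/-- **Transport along an endpoint-preserving bijection of edge types** (`dFreeIneq_map` with the
identity on vertices). -/
theorem dFreeIneq_of_edgeEquiv {E₁ E₂ : Type*} [Fintype E₁] [DecidableEq E₁] [Fintype E₂]
    [DecidableEq E₂] {A : MultiGraph V E₁} {B : MultiGraph V E₂} (ε : E₁ ≃ E₂)
    (hfst : ∀ e, B.fst (ε e) = A.fst e) (hsnd : ∀ e, B.snd (ε e) = A.snd e) {a b c : V}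
    (h : A.DFreeIneq a b c) : B.DFreeIneq a b c :=
  dFreeIneq_map (ε := ε) (φ := id) hfst hsnd (fun _ _ _ _ h => h) h

variable (G)

/-- The edges of colour `i` among those of colour in `insert i s`: the `true` part of `colSide`. -/
def colEquivTrue [DecidableEq ι] (col : E → ι) (i : ι) (s : Finset ι) :
    {e // col e = i} ≃ {e : {e // col e ∈ insert i s} // colSide col i s e = true} where
  toFun e := ⟨⟨e.1, by rw [e.2]; exact Finset.mem_insert_self i s⟩, decide_eq_true e.2⟩
  invFun e := ⟨e.1.1, of_decide_eq_true e.2⟩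
  left_inv _ := rfl
  right_inv _ := rfl

/-- The edges of colour in `s` among those of colour in `insert i s` (`i ∉ s`): the `false` part of
`colSide`. -/
def colEquivFalse [DecidableEq ι] (col : E → ι) (i : ι) (s : Finset ι) (hi : i ∉ s) :
    {e // col e ∈ s} ≃ {e : {e // col e ∈ insert i s} // colSide col i s e = false} where
  toFun e := ⟨⟨e.1, Finset.mem_insert_of_mem e.2⟩,
    decide_eq_false fun h : col e.1 = i => hi (h ▸ e.2)⟩
  invFun e := ⟨e.1.1, (Finset.mem_insert.mp e.1.2).resolve_left (of_decide_eq_false e.2)⟩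
  left_inv _ := rfl
  right_inv _ := rfl

/-- **The edges of colour in `insert i s` form a two-coloured gluing** («colour `i`» versus the rest):
a non-mark carries one colour of `col`, hence one value of `colSide`. -/
theorem isGluing_colSub [DecidableEq ι] (a b c : V) (col : E → ι) (hg : G.IsGluingN a b c col)
    (i : ι) (s : Finset ι) : (G.colSub col (insert i s)).IsGluing a b c (colSide col i s) := by
  intro v hva hvb hvc e e' he he'
  have h := hg v hva hvb hvc e.1 e'.1 he he'
  show decide (col e.1 = i) = decide (col e'.1 = i)
  rw [h]

/-- **The composition theorem on a finset of colours**: if every colour class with colour in `s`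
satisfies the D-free inequality, so does the subgraph of the edges of colour in `s`.  Induction on `s`:
the empty subgraph by `dFreeIneq_of_isEmpty`; the step `insert i s` is the two-part composition theorem
for «colour `i`» against «colour in `s`», the two parts transported from `colPart col i` and
`colSub col s`. -/
theorem dFreeIneq_colSub [Fintype E] [DecidableEq E] [DecidableEq ι] (a b c : V) (hab : a ≠ b)
    (hac : a ≠ c) (hbc : b ≠ c) (col : E → ι) (hg : G.IsGluingN a b c col) (s : Finset ι)
    (h : ∀ i ∈ s, (G.colPart col i).DFreeIneq a b c) : (G.colSub col s).DFreeIneq a b c := by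
  revert h
  refine Finset.induction_on s ?_ ?_
  · intro _
    haveI : IsEmpty {e // col e ∈ (∅ : Finset ι)} := ⟨fun e => Finset.notMem_empty _ e.2⟩
    exact dFreeIneq_of_isEmpty _ a b c
  · intro i s hi ih h
    have h₁ : ((G.colSub col (insert i s)).part (colSide col i s) true).DFreeIneq a b c :=
      dFreeIneq_of_edgeEquiv (colEquivTrue col i s) (fun _ => rfl) (fun _ => rfl)
        (h i (Finset.mem_insert_self i s))
    have h₀ : ((G.colSub col (insert i s)).part (colSide col i s) false).DFreeIneq a b c :=
      dFreeIneq_of_edgeEquiv (colEquivFalse col i s hi) (fun _ => rfl) (fun _ => rfl)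
        (ih fun j hj => h j (Finset.mem_insert_of_mem hj))
    exact dFreeIneq_of_gluing _ a b c hab hac hbc (colSide col i s)
      (G.isGluing_colSub a b c col hg i s) h₁ h₀

/-- **THE COMPOSITION THEOREM FOR ANY NUMBER OF COLOURS**: if the edges of `G` are coloured by `ι` so
that every vertex other than the marks carries one colour, and every colour class satisfies the D-free
inequality, then `G` does. -/
theorem dFreeIneq_of_gluingN [Fintype E] [DecidableEq E] [Fintype ι] [DecidableEq ι] (a b c : V)
    (hab : a ≠ b) (hac : a ≠ c) (hbc : b ≠ c) (col : E → ι) (hg : G.IsGluingN a b c col)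
    (h : ∀ i, (G.colPart col i).DFreeIneq a b c) : G.DFreeIneq a b c :=
  dFreeIneq_of_edgeEquiv (Equiv.subtypeUnivEquiv fun e => Finset.mem_univ (col e)) (fun _ => rfl)
    (fun _ => rfl) (G.dFreeIneq_colSub a b c hab hac hbc col hg Finset.univ fun i _ => h i)

/-- **Corollary**: an `ι`-coloured gluing whose colour classes satisfy mine-3's `(★′)`
(`StarPrimeIneq`) satisfies the D-free inequality (via `dFreeIneq_of_starPrime`). -/
theorem dFreeIneq_of_gluingN_starPrime [Fintype E] [DecidableEq E] [Fintype ι] [DecidableEq ι]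
    (a b c : V) (hab : a ≠ b) (hac : a ≠ c) (hbc : b ≠ c) (col : E → ι)
    (hg : G.IsGluingN a b c col) (h : ∀ i, (G.colPart col i).StarPrimeIneq a b c) :
    G.DFreeIneq a b c :=
  G.dFreeIneq_of_gluingN a b c hab hac hbc col hg fun i => dFreeIneq_of_starPrime _ (h i)

/-- **The `n`-colour composition theorem**: `dFreeIneq_of_gluingN` for the colours `Fin n`. -/
theorem dFreeIneq_of_gluingFin [Fintype E] [DecidableEq E] (n : ℕ) (a b c : V) (hab : a ≠ b)
    (hac : a ≠ c) (hbc : b ≠ c) (col : E → Fin n) (hg : G.IsGluingN a b c col)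
    (h : ∀ i, (G.colPart col i).DFreeIneq a b c) : G.DFreeIneq a b c :=
  G.dFreeIneq_of_gluingN a b c hab hac hbc col hg h

end GluingN

end MultiGraph

end PercRepro
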